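import Summits.RiemannHypothesis.RiemannHypothesis.Theses.LiAsymptotic
import Summits.RiemannHypothesis.RiemannHypothesis.Theorems.LiAsymptoticLiBoxTwoSided
import Summits.RiemannHypothesis.RiemannHypothesis.Theorems.LiAsymptoticLiSmoothMainTerm
import Summits.RiemannHypothesis.RiemannHypothesis.Theorems.LiAsymptoticLiOscillatoryS
import Summits.RiemannHypothesis.RiemannHypothesis.Theorems.LiAsymptoticLiAsymptoticBudget
import Summits.RiemannHypothesis.RiemannHypothesis.Theorems.LiAsymptoticAssembly
import HarnessLib

/-!
# RiemannHypothesis / LiAsymptotic — CAPSTONE: the Li asymptotic law in the verified range is a theorem (RH-FREE)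

RH-FREE [rh-li-prover].  Route `Theses/LiAsymptotic.lean` (rung L-P(P1⁺), cell `pub/rh-li`): the route's `closes`
composition applied to the five landed binders — `liBoxTwoSided_proof` (K1, rh-li-prover g2),
`liSmoothMainTerm_proof` (K2), `liOscillatoryS_proof` (K3), `liAsymptoticBudget_proof` (K4, g2),
`liAsymptotic_assembly_proof` (Assembly, g2) — gives the LEAF

  `LiTheory.LiAsymptoticLawQuadratic`: if every zero of `ζ` with `0 < Im ρ ≤ T` (`T ≥ 1000`) lies on the critical
  line, then for all `n ≤ T²/4`: `|λ_n − (n/2) log n − C₁ n| ≤ 2√n log n` (`n ≥ 900`) and `≤ (1/3)√n log n`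
  (`n ≥ 3·10⁵`),

and its three free corollaries from `LiAsymptoticDefs` (`liAsymptoticPlattTrudgian_of`, `liPrimePartBound_of`,
`keiperLiCoeff_pos_of_liAsymptoticLawQuadratic`).  A FINITE verified height, finitely many coefficients: a proof of
data, not of RH; nothing here bears on the truth of RH.
-/

noncomputable section

-- D-0017: `Summit.<S>.<S>.…` is the designed namespace of a single-problem summit.
set_option linter.dupNamespace false

namespace Summit.RiemannHypothesis.RiemannHypothesis.Theorems.LiTheory

open Literature.NumberTheory.LFunctions Literature.NumberTheory.LFunctions.SchoenfeldBound
open Literature.NumberTheory.DiophantineGeometry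

open Summit.RiemannHypothesis.RiemannHypothesis.Theses.LiAsymptotic in
/-- **The Li asymptotic law in the verified range (LEAF of route `LiAsymptotic`, rung L-P(P1⁺); RH-FREE).**
`LiAsymptoticLawQuadratic` is a theorem: the route's `closes` applied to the five landed binders. -/
theorem liAsymptoticLawQuadratic_proof : LiAsymptoticLawQuadratic :=
  closes liBoxTwoSided_proof liSmoothMainTerm_proof liOscillatoryS_proof liAsymptoticBudget_proof
    liAsymptotic_assembly_proof

/-- **Corollary at the Platt–Trudgian height** (RH-FREE): `LiAsymptoticPlattTrudgian` holds —
`|λ_n − (n/2) log n − C₁ n| ≤ (1/3)√n log n` for `3·10⁵ ≤ n ≤ 2.25·10²⁴` (and `≤ 2√n log n` from `n = 900`),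
given the Platt–Trudgian verification as its stated hypothesis. -/
theorem liAsymptoticPlattTrudgian_holds : LiAsymptoticPlattTrudgian :=
  liAsymptoticPlattTrudgian_of liAsymptoticLawQuadratic_proof

/-- **Corollary (Keiper's prime part is `O(√n log n)` in the verified range; RH-FREE)**: `LiPrimePartBound` holds. -/
theorem liPrimePartBound_holds : LiPrimePartBound :=
  liPrimePartBound_of liAsymptoticLawQuadratic_proof

/-- **Corollary (positivity in the Turing range; RH-FREE)**: for RH verified to `T ≥ 1000`, `3·10⁵ ≤ n ≤ T²/4`, and the
(numerical) comparison `(1/3)√n log n < liMainTerm n`, Keiper's `λ_n > 0`. -/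
theorem keiperLiCoeff_pos_of_verified {T : ℝ} (hT : 1000 ≤ T)
    (hRH : RiemannHypothesisUpTo T) {n : ℕ} (hn : 300000 ≤ n)
    (hnc : (n : ℝ) ≤ 1 / 4 * T ^ 2) (hband : 1 / 3 * Real.sqrt n * Real.log n < liMainTerm n) :
    0 < keiperLiCoeff n :=
  keiperLiCoeff_pos_of_liAsymptoticLawQuadratic liAsymptoticLawQuadratic_proof hT hRH hn hnc hband

end Summit.RiemannHypothesis.RiemannHypothesis.Theorems.LiTheory
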